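/-
Origin: expansion seat `planner-pub-hodgecm-pv01-g2-0`, handover 2026-08-18T04:59:07Z (`HOME/pub-hodgecm-pv01-g2/lean/Pv01g2/RealApproximation.lean`, md5 026f0a30, 587 lines);
landed by the gen-6 packager in gate run 22 as `HodgeCM/PerL34/RealApproximation.lean` (stripped 3 #print/#check/#eval lines).
-/
/-
Copyright: pub-hodgecm formalisation cell (harness21, 2026). New file (not vendored).
Origin: HOME/pub-hodgecm-pv01-g2/lean/Pv01g2/RealApproximation.lean (WIP module `Pv01g2.RealApproximation`;
intended final place `HodgeCM/PerL34/RealApproximation.lean` = module `HodgeCM.PerL34.RealApproximation`)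
(seat planner-pub-hodgecm-pv01-g2-0, DAG-node prover #01 gen 2; PRINT leaf `FormsModelT.Print_dense` of DAG node
N33e, PerL v5 Prop 4.3, tex ll. 672–677, and the same printed input at node N23c, tex l. 432).
-/
import Mathlib

/-!
# Real approximation for unitary groups of hermitian forms, by the Cayley transform

PerL v5 uses twice, as a citation, the density of the rational points of a unitary group in its real points:

* Prop 4.3 (node N33e, ll. 672–677): "the image `Δ` of `G_U(L₀)` is dense in `U(2,1)`", cited there to
  [San] = Sansuc, *J. reine angew. Math.* 327 (1981) Cor. 3.5(iii) and [PR] = Platonov–Rapinchuk Thm 7.7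
  (neither text is held by the cell; held substitute: Borovoi, arXiv:0804.4767, Cor. 3.13);
* Lemma 3.3 (node N23c, l. 432): "`U(W)(L₀)` is dense in `U(W)(L₀ ⊗ ℝ)`".

This file PROVES the single-place statement in Mathlib generality, with no algebraic-group theory, by the
CAYLEY TRANSFORM.  Setting: `K ⊆ ℂ` a subfield which is stable under complex conjugation and dense (for the
image `K = ι₁(L)` of a CM field under a complex embedding both are automatic: `dense_fieldRange_of_not_isReal`,
`conj_mem_fieldRange_of_isCMField`); `H ∈ Mₙ(K)` hermitian with `det H ≠ 0`; `U(H) = {G ∈ Mₙ(ℂ) | Gᴴ H G = H}`.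

* `closure_kUnitary` : every `G ∈ U(H)` lies in the closure of `U(H)(K) = {G ∈ Mₙ(K) | Gᴴ H G = H}`.
  Proof: (1) `K`-matrices `X` with `Xᴴ H = -H X` are dense among all such complex matrices (they are the
  image of the dense set `Mₙ(K)` under `M ↦ H⁻¹ (M - Mᴴ)`); (2) the Cayley map `X ↦ (1+X)(1-X)⁻¹` is continuous
  where `det (1-X) ≠ 0`, preserves `K`-rationality, sends such `X` into `U(H)`, and hits every `G ∈ U(H)` with
  `det (1+G) ≠ 0`; (3) a general `G ∈ U(H)` is `(ζ • 1) * (ζ⁻¹ • G)` with a unit scalar `ζ = (1+it)/(1-it)`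
  (never `-1`) chosen off the finitely many `ζ` with `det (1 + ζ⁻¹ G) = 0`, and the closure of the monoid
  `U(H)(K)` is closed under products.
* `dense_kPoints` : the same in the topology of `GL n ℂ` (Mathlib's topology on units), for any subgroup
  `S ≤ GL n ℂ` cut out by `gᴴ J g = J` and any `T ∈ GL n ℂ` with `Tᴴ H T = J`: the elements `u ∈ S` whose
  `H`-avatar `T u T⁻¹` has entries in `K` are DENSE in `S`.  With `n = Fin 3`, `J = diag(1,1,-1)`, `S = U21` of
  `HodgeCM.PerL34.Ball` and `K = ι₁(L)` this is `FormsModelT.Print_dense` for the dictionary value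
  `Δ = image of G_U(L₀) = U(Hm)(L)` (the `L`-points of the unitary group of the hermitian space `(V₃, h)`,
  `HodgeCM.HermSpace3.signature_ι₁` supplying `T`) — see `RealApproximationBall.lean`.

Kernel-checked from Mathlib alone; standard axioms only (see the `#print axioms` lines at the end).
-/

set_option autoImplicit false

noncomputable section

open Matrix Topology Filter
open scoped ComplexConjugate

namespace HodgeCM
namespace PerL34
namespace RealApproximation

variable {m n : Type*} [Fintype n] [DecidableEq n]

/-! ## Matrices with entries in a subfield `K ⊆ ℂ` -/

/-- `A` has all its entries in the subfield `K`. -/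
def IsKMat (K : Subfield ℂ) {m m' : Type*} (A : Matrix m m' ℂ) : Prop := ∀ i j, A i j ∈ K

namespace IsKMat

variable {K : Subfield ℂ}

/-- (Ported verbatim from the HodgeCMPerL package; no docstring in the source.) -/
theorem exists_map {A : Matrix n n ℂ} (hA : IsKMat K A) : ∃ B : Matrix n n K, K.subtype.mapMatrix B = A :=
  ⟨Matrix.of fun i j => ⟨A i j, hA i j⟩, by ext i j; rfl⟩

/-- (Ported verbatim from the HodgeCMPerL package; no docstring in the source.) -/
theorem of_map (B : Matrix n n K) : IsKMat K (K.subtype.mapMatrix B) :=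
  fun i j => (B i j).2

/-- (Ported verbatim from the HodgeCMPerL package; no docstring in the source.) -/
theorem zero {m m' : Type*} : IsKMat K (0 : Matrix m m' ℂ) := fun _ _ => K.zero_mem

omit [Fintype n] in
/-- (Ported verbatim from the HodgeCMPerL package; no docstring in the source.) -/
theorem one : IsKMat K (1 : Matrix n n ℂ) := by
  intro i j
  rw [Matrix.one_apply]
  split_ifs
  · exact K.one_mem
  · exact K.zero_mem

/-- (Ported verbatim from the HodgeCMPerL package; no docstring in the source.) -/
theorem add {m m' : Type*} {A B : Matrix m m' ℂ} (hA : IsKMat K A) (hB : IsKMat K B) : IsKMat K (A + B) :=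
  fun i j => K.add_mem (hA i j) (hB i j)

/-- (Ported verbatim from the HodgeCMPerL package; no docstring in the source.) -/
theorem neg {m m' : Type*} {A : Matrix m m' ℂ} (hA : IsKMat K A) : IsKMat K (-A) :=
  fun i j => K.neg_mem (hA i j)

/-- (Ported verbatim from the HodgeCMPerL package; no docstring in the source.) -/
theorem sub {m m' : Type*} {A B : Matrix m m' ℂ} (hA : IsKMat K A) (hB : IsKMat K B) : IsKMat K (A - B) :=
  fun i j => K.sub_mem (hA i j) (hB i j)

/-- (Ported verbatim from the HodgeCMPerL package; no docstring in the source.) -/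
theorem smul {m m' : Type*} {A : Matrix m m' ℂ} {c : ℂ} (hc : c ∈ K) (hA : IsKMat K A) : IsKMat K (c • A) :=
  fun i j => by simpa [Matrix.smul_apply] using K.mul_mem hc (hA i j)

/-- (Ported verbatim from the HodgeCMPerL package; no docstring in the source.) -/
theorem mul {l m m' : Type*} [Fintype m] {A : Matrix l m ℂ} {B : Matrix m m' ℂ} (hA : IsKMat K A)
    (hB : IsKMat K B) : IsKMat K (A * B) := fun i j => by
  rw [Matrix.mul_apply]
  exact K.sum_mem fun k _ => K.mul_mem (hA i k) (hB k j)

/-- If `K` is stable under complex conjugation, `K`-matrices are stable under `ᴴ`. -/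
theorem conjTranspose {m m' : Type*} (hK : ∀ z ∈ K, conj z ∈ K) {A : Matrix m m' ℂ} (hA : IsKMat K A) :
    IsKMat K Aᴴ := fun i j => by
  rw [Matrix.conjTranspose_apply]
  exact hK _ (hA j i)

/-- (Ported verbatim from the HodgeCMPerL package; no docstring in the source.) -/
theorem det_mem {A : Matrix n n ℂ} (hA : IsKMat K A) : A.det ∈ K := by
  obtain ⟨B, rfl⟩ := hA.exists_map
  rw [← RingHom.map_det]
  exact (B.det).2

/-- (Ported verbatim from the HodgeCMPerL package; no docstring in the source.) -/
theorem adjugate {A : Matrix n n ℂ} (hA : IsKMat K A) : IsKMat K A.adjugate := by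
  obtain ⟨B, rfl⟩ := hA.exists_map
  rw [← RingHom.map_adjugate]
  exact of_map _

/-- (Ported verbatim from the HodgeCMPerL package; no docstring in the source.) -/
theorem inv {A : Matrix n n ℂ} (hA : IsKMat K A) : IsKMat K A⁻¹ := by
  rw [Matrix.inv_def, Ring.inverse_eq_inv']
  exact (hA.adjugate).smul (K.inv_mem hA.det_mem)

end IsKMat

/-- `K`-matrices are dense as soon as `K` is dense in `ℂ`. -/
theorem dense_isKMat {K : Subfield ℂ} (hKd : Dense (K : Set ℂ)) (m m' : Type*) :
    Dense {A : Matrix m m' ℂ | IsKMat K A} := by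
  have h : DenseRange (Pi.map fun _ : m => Pi.map fun _ : m' => ((↑) : K → ℂ)) :=
    DenseRange.piMap fun _ => DenseRange.piMap fun _ => hKd.denseRange_val
  refine Dense.mono ?_ h
  rintro _ ⟨B, rfl⟩ i j
  exact (B i j).2

/-! ## Dense conjugation-stable subfields: the image of a CM field -/

/-- A subfield of `ℂ` containing a non-real number is dense. -/
theorem Subfield.dense_of_im_ne_zero (K : Subfield ℂ) {z : ℂ} (hz : z ∈ K) (hz' : z.im ≠ 0) :
    Dense (K : Set ℂ) := by
  let φ : ℝ × ℝ → ℂ := fun p => (p.1 : ℂ) + (p.2 : ℂ) * z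
  have hφc : Continuous φ := by
    simp only [φ]
    fun_prop
  have hφs : Function.Surjective φ := by
    intro w
    refine ⟨(w.re - w.im / z.im * z.re, w.im / z.im), ?_⟩
    apply Complex.ext
    · simp [φ]
    · simp [φ]
      field_simp
  have hg : DenseRange (Prod.map ((↑) : ℚ → ℝ) ((↑) : ℚ → ℝ)) :=
    Rat.denseRange_cast.prodMap Rat.denseRange_cast
  have hd : DenseRange (φ ∘ Prod.map ((↑) : ℚ → ℝ) ((↑) : ℚ → ℝ)) := hφs.denseRange.comp hg hφc
  refine Dense.mono ?_ hd
  rintro _ ⟨⟨p, q⟩, rfl⟩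
  simp only [Function.comp_apply, Prod.map_apply, φ, Complex.ofReal_ratCast]
  exact K.add_mem (SubfieldClass.ratCast_mem K p) (K.mul_mem (SubfieldClass.ratCast_mem K q) hz)

/-- The image of a non-real complex embedding of a field is dense in `ℂ`. -/
theorem dense_fieldRange_of_not_isReal {L : Type*} [Field L] (ι : L →+* ℂ)
    (h : ¬ NumberField.ComplexEmbedding.IsReal ι) : Dense (ι.fieldRange : Set ℂ) := by
  rw [NumberField.ComplexEmbedding.isReal_iff] at h
  obtain ⟨x, hx⟩ : ∃ x, NumberField.ComplexEmbedding.conjugate ι x ≠ ι x := by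
    by_contra hall
    push Not at hall
    exact h (RingHom.ext hall)
  rw [NumberField.ComplexEmbedding.conjugate_coe_eq, Ne, Complex.conj_eq_iff_im] at hx
  exact Subfield.dense_of_im_ne_zero _ (ι.mem_fieldRange.mpr ⟨x, rfl⟩) hx

/-- Every complex embedding of a totally complex field (e.g. a CM field) has dense image. -/
theorem dense_fieldRange_of_isTotallyComplex {L : Type*} [Field L] [NumberField L]
    [NumberField.IsTotallyComplex L] (ι : L →+* ℂ) : Dense (ι.fieldRange : Set ℂ) :=
  dense_fieldRange_of_not_isReal ι (NumberField.IsTotallyComplex.complexEmbedding_not_isReal ι)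

/-- The image of a CM field under a complex embedding is stable under complex conjugation. -/
theorem conj_mem_fieldRange_of_isCMField {L : Type*} [Field L] [NumberField L] [NumberField.IsCMField L]
    (ι : L →+* ℂ) : ∀ z ∈ ι.fieldRange, conj z ∈ ι.fieldRange := by
  rintro _ ⟨x, rfl⟩
  exact ⟨NumberField.IsCMField.complexConj L x, NumberField.IsCMField.complexEmbedding_complexConj L ι x⟩

/-! ## The unitary monoid of `H` over `K`, and `H`-skew-adjoint matrices -/

section Core

variable (K : Subfield ℂ) (H : Matrix n n ℂ)

/-- `U(H)(K)`: the `K`-matrices `G` with `Gᴴ H G = H`, as a submonoid of `Mₙ(ℂ)`. -/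
def kUnitary : Submonoid (Matrix n n ℂ) where
  carrier := {G | IsKMat K G ∧ Gᴴ * H * G = H}
  one_mem' := ⟨IsKMat.one, by simp⟩
  mul_mem' := by
    rintro A B ⟨hAK, hA⟩ ⟨hBK, hB⟩
    refine ⟨hAK.mul hBK, ?_⟩
    calc (A * B)ᴴ * H * (A * B) = Bᴴ * (Aᴴ * H * A) * B := by
          simp only [conjTranspose_mul, Matrix.mul_assoc]
      _ = H := by rw [hA, hB]

/-- (Ported verbatim from the HodgeCMPerL package; no docstring in the source.) -/
theorem mem_kUnitary_iff {G : Matrix n n ℂ} : G ∈ kUnitary K H ↔ IsKMat K G ∧ Gᴴ * H * G = H := Iff.rfl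

/-- The `H`-skew-adjoint matrices (`Xᴴ H = -H X`), the Lie algebra of `U(H)`. -/
def skewSet : Set (Matrix n n ℂ) := {X | Xᴴ * H = -(H * X)}

variable {K H}

omit [DecidableEq n] in
/-- (Ported verbatim from the HodgeCMPerL package; no docstring in the source.) -/
theorem mem_skewSet_iff {X : Matrix n n ℂ} : X ∈ skewSet H ↔ Xᴴ * H = -(H * X) := Iff.rfl

/-- The parametrisation `M ↦ H⁻¹ (M - Mᴴ)` lands in the `H`-skew-adjoint matrices. -/
theorem param_mem_skewSet (hH : Hᴴ = H) (hHd : IsUnit H.det) (M : Matrix n n ℂ) :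
    H⁻¹ * (M - Mᴴ) ∈ skewSet H := by
  rw [mem_skewSet_iff, conjTranspose_mul, conjTranspose_nonsing_inv, hH, conjTranspose_sub,
    conjTranspose_conjTranspose, Matrix.mul_assoc, nonsing_inv_mul _ hHd, Matrix.mul_one,
    ← Matrix.mul_assoc, mul_nonsing_inv _ hHd, Matrix.one_mul, neg_sub]

/-- ... and it is onto: `X = H⁻¹ (M - Mᴴ)` for `M = ½ H X`. -/
theorem param_half (hH : Hᴴ = H) (hHd : IsUnit H.det) {X : Matrix n n ℂ} (hX : X ∈ skewSet H) :
    H⁻¹ * ((2 : ℂ)⁻¹ • (H * X) - ((2 : ℂ)⁻¹ • (H * X))ᴴ) = X := by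
  have h1 : ((2 : ℂ)⁻¹ • (H * X))ᴴ = -((2 : ℂ)⁻¹ • (H * X)) := by
    rw [conjTranspose_smul, conjTranspose_mul, hH, hX, smul_neg]
    congr 1
    simp
  rw [h1, sub_neg_eq_add, ← two_smul ℂ, smul_smul, mul_inv_cancel₀ (two_ne_zero : (2 : ℂ) ≠ 0), one_smul,
    ← Matrix.mul_assoc, nonsing_inv_mul _ hHd, Matrix.one_mul]

/-- **Step 1.** `K`-rational `H`-skew-adjoint matrices are dense in all `H`-skew-adjoint matrices. -/
theorem skewSet_subset_closure (hK : ∀ z ∈ K, conj z ∈ K) (hKd : Dense (K : Set ℂ)) (hHK : IsKMat K H)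
    (hH : Hᴴ = H) (hHd : IsUnit H.det) :
    skewSet H ⊆ closure {X | IsKMat K X ∧ X ∈ skewSet H} := by
  intro X hX
  let φ : Matrix n n ℂ → Matrix n n ℂ := fun M => H⁻¹ * (M - Mᴴ)
  have hφc : Continuous φ :=
    continuous_const.matrix_mul (continuous_id.sub continuous_id.matrix_conjTranspose)
  have hmem : (2 : ℂ)⁻¹ • (H * X) ∈ closure {A : Matrix n n ℂ | IsKMat K A} := dense_isKMat hKd n n _
  have himg := hφc.continuousWithinAt.mem_closure_image hmem
  rw [show φ ((2 : ℂ)⁻¹ • (H * X)) = X from param_half hH hHd hX] at himg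
  refine closure_mono ?_ himg
  rintro _ ⟨M, hM, rfl⟩
  exact ⟨(hHK.inv).mul (IsKMat.sub hM (hM.conjTranspose hK)), param_mem_skewSet hH hHd M⟩

/-! ## The Cayley transform -/

/-- The Cayley transform `C(X) = (1 + X)(1 - X)⁻¹`. -/
def cayley (X : Matrix n n ℂ) : Matrix n n ℂ := (1 + X) * (1 - X)⁻¹

/-- (Ported verbatim from the HodgeCMPerL package; no docstring in the source.) -/
theorem cayley_isKMat {X : Matrix n n ℂ} (hX : IsKMat K X) : IsKMat K (cayley X) :=
  (IsKMat.one.add hX).mul (IsKMat.one.sub hX).inv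

/-- Characterisation: if `Y (1 - X) = 1 + X` and `1 - X` is invertible then `C(X) = Y`. -/
theorem cayley_eq_of_mul_eq {X Y : Matrix n n ℂ} (hu : IsUnit (1 - X).det) (h : Y * (1 - X) = 1 + X) :
    cayley X = Y := by
  rw [cayley, ← h, mul_nonsing_inv_cancel_right _ _ hu]

/-- The Cayley transform is continuous at every `X` with `det (1 - X) ≠ 0`. -/
theorem continuousAt_cayley {X : Matrix n n ℂ} (hu : (1 - X).det ≠ 0) : ContinuousAt cayley X := by
  have h1 : ContinuousAt (fun Y : Matrix n n ℂ => 1 - Y) X := (continuous_const.sub continuous_id).continuousAt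
  have h2 : ContinuousAt Inv.inv (1 - X) := by
    refine continuousAt_matrix_inv _ ?_
    rw [Ring.inverse_eq_inv']
    exact continuousAt_inv₀ hu
  exact ((continuous_const.add continuous_id).continuousAt).mul (h2.comp h1)

/-- **Step 2a.** The Cayley transform of an `H`-skew-adjoint `X` with `1 - X` invertible is in `U(H)`. -/
theorem cayley_unitary {X : Matrix n n ℂ} (hX : X ∈ skewSet H) (hu : IsUnit (1 - X).det) :
    (cayley X)ᴴ * H * cayley X = H := by
  have hXH : Xᴴ * H = -(H * X) := hX
  -- the two intertwining identities
  have e1 : (1 + X)ᴴ * H = H * (1 - X) := by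
    rw [conjTranspose_add, conjTranspose_one, add_mul, Matrix.one_mul, hXH, mul_sub, Matrix.mul_one,
      sub_eq_add_neg]
  have e2 : (1 - X)ᴴ * H = H * (1 + X) := by
    rw [conjTranspose_sub, conjTranspose_one, sub_mul, Matrix.one_mul, hXH, sub_neg_eq_add, mul_add,
      Matrix.mul_one]
  have comm : (1 - X) * (1 + X) = (1 + X) * (1 - X) := by
    simp only [mul_add, add_mul, mul_sub, sub_mul, Matrix.mul_one, Matrix.one_mul]
    abel
  have huH : IsUnit (1 - X)ᴴ.det := by
    rw [det_conjTranspose]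
    exact hu.star
  calc (cayley X)ᴴ * H * cayley X
      = (1 - X)ᴴ⁻¹ * ((1 + X)ᴴ * H) * (1 + X) * (1 - X)⁻¹ := by
        simp only [cayley, conjTranspose_mul, conjTranspose_nonsing_inv, Matrix.mul_assoc]
    _ = (1 - X)ᴴ⁻¹ * H * ((1 - X) * (1 + X)) * (1 - X)⁻¹ := by
        rw [e1]; simp only [Matrix.mul_assoc]
    _ = (1 - X)ᴴ⁻¹ * (H * (1 + X)) * ((1 - X) * (1 - X)⁻¹) := by
        rw [comm]; simp only [Matrix.mul_assoc]
    _ = (1 - X)ᴴ⁻¹ * ((1 - X)ᴴ * H) := by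
        rw [mul_nonsing_inv _ hu, Matrix.mul_one, e2]
    _ = H := by
        rw [← Matrix.mul_assoc, nonsing_inv_mul _ huH, Matrix.one_mul]

/-- **Step 2b.** Every `G ∈ U(H)` with `det (1 + G) ≠ 0` is a Cayley transform, hence in the closure of
`U(H)(K)`. -/
theorem mem_closure_kUnitary_of_det_ne_zero (hK : ∀ z ∈ K, conj z ∈ K) (hKd : Dense (K : Set ℂ))
    (hHK : IsKMat K H) (hH : Hᴴ = H) (hHd : IsUnit H.det) {G : Matrix n n ℂ} (hG : Gᴴ * H * G = H)
    (hG1 : (1 + G).det ≠ 0) : G ∈ closure (kUnitary K H : Set (Matrix n n ℂ)) := by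
  have hu1 : IsUnit (1 + G).det := isUnit_iff_ne_zero.mpr hG1
  -- the inverse Cayley transform of `G`
  set X : Matrix n n ℂ := (G - 1) * (1 + G)⁻¹ with hXdef
  -- (1 - X)(1 + G) = 2
  have h1X : (1 - X) * (1 + G) = (2 : ℂ) • (1 : Matrix n n ℂ) := by
    rw [hXdef, sub_mul, Matrix.one_mul, Matrix.mul_assoc, nonsing_inv_mul _ hu1, Matrix.mul_one, two_smul]
    abel
  have hu : IsUnit (1 - X).det := by
    have h := congrArg Matrix.det h1X
    rw [det_mul, det_smul, det_one, mul_one] at h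
    rw [isUnit_iff_ne_zero]
    intro h0
    rw [h0, zero_mul] at h
    exact pow_ne_zero _ two_ne_zero h.symm
  -- G (1 - X) = 1 + X, checked after multiplying by the invertible (1 + G) on the right
  have hGX : G * (1 - X) = 1 + X := by
    have key : G * (1 - X) * (1 + G) = (1 + X) * (1 + G) := by
      rw [Matrix.mul_assoc, h1X, hXdef, add_mul, Matrix.one_mul, Matrix.mul_assoc, nonsing_inv_mul _ hu1,
        Matrix.mul_one, Matrix.mul_smul, Matrix.mul_one, two_smul]
      abel
    calc G * (1 - X) = G * (1 - X) * (1 + G) * (1 + G)⁻¹ := by rw [mul_nonsing_inv_cancel_right _ _ hu1]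
      _ = (1 + X) * (1 + G) * (1 + G)⁻¹ := by rw [key]
      _ = 1 + X := by rw [mul_nonsing_inv_cancel_right _ _ hu1]
  have hcay : cayley X = G := cayley_eq_of_mul_eq hu hGX
  -- X is H-skew-adjoint
  have hX : X ∈ skewSet H := by
    rw [mem_skewSet_iff, ← add_eq_zero_iff_eq_neg]
    have hu1H : IsUnit (1 + G)ᴴ.det := by rw [det_conjTranspose]; exact hu1.star
    have eX : Xᴴ * H = (1 + G)ᴴ⁻¹ * ((Gᴴ - 1) * H * (1 + G)) * (1 + G)⁻¹ := by
      rw [hXdef, conjTranspose_mul, conjTranspose_nonsing_inv, conjTranspose_sub, conjTranspose_one]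
      simp only [Matrix.mul_assoc]
      rw [mul_nonsing_inv _ hu1, Matrix.mul_one]
    have eY : H * X = (1 + G)ᴴ⁻¹ * ((Gᴴ + 1) * H * (G - 1)) * (1 + G)⁻¹ := by
      have hc : Gᴴ + 1 = (1 + G)ᴴ := by rw [conjTranspose_add, conjTranspose_one, add_comm]
      rw [hc, hXdef]
      simp only [Matrix.mul_assoc]
      rw [← Matrix.mul_assoc (1 + G)ᴴ⁻¹, nonsing_inv_mul _ hu1H, Matrix.one_mul]
    have bracket : (Gᴴ - 1) * H * (1 + G) + (Gᴴ + 1) * H * (G - 1) = (2 : ℂ) • (Gᴴ * H * G - H) := by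
      rw [two_smul]
      simp only [sub_mul, add_mul, mul_add, mul_sub, Matrix.one_mul, Matrix.mul_one]
      abel
    rw [eX, eY, ← Matrix.add_mul, ← Matrix.mul_add, bracket, hG, sub_self, smul_zero, Matrix.mul_zero,
      Matrix.zero_mul]
  -- density: X ∈ closure of the K-rational skew matrices with det (1 - ·) ≠ 0, push through `cayley`
  have hXcl : X ∈ closure {Y | IsKMat K Y ∧ Y ∈ skewSet H} := skewSet_subset_closure hK hKd hHK hH hHd hX
  have hO : IsOpen {Y : Matrix n n ℂ | (1 - Y).det ≠ 0} :=
    isOpen_ne_fun ((continuous_const.sub continuous_id).matrix_det) continuous_const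
  have hXO : X ∈ {Y : Matrix n n ℂ | (1 - Y).det ≠ 0} := isUnit_iff_ne_zero.mp hu
  have hXcl' : X ∈ closure ({Y : Matrix n n ℂ | (1 - Y).det ≠ 0} ∩ {Y | IsKMat K Y ∧ Y ∈ skewSet H}) :=
    hO.inter_closure ⟨hXO, hXcl⟩
  have himg := (continuousAt_cayley (isUnit_iff_ne_zero.mp hu)).continuousWithinAt.mem_closure_image hXcl'
  rw [hcay] at himg
  refine closure_mono ?_ himg
  rintro _ ⟨Y, ⟨hYu, hYK, hYs⟩, rfl⟩
  exact ⟨cayley_isKMat hYK, cayley_unitary hYs (isUnit_iff_ne_zero.mpr hYu)⟩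

/-! ## Unit scalars: removing the condition `det (1 + G) ≠ 0` -/

/-- Unit scalar multiples of elements of `U(H)` are in `U(H)`. -/
theorem smul_unitary {G : Matrix n n ℂ} (hG : Gᴴ * H * G = H) {ζ : ℂ} (hζ : conj ζ * ζ = 1) :
    (ζ • G)ᴴ * H * (ζ • G) = H := by
  rw [conjTranspose_smul, Complex.star_def, smul_mul_assoc, smul_mul_assoc, mul_smul_comm, smul_smul, hζ,
    one_smul, hG]


-- port_pkg: scope closed for this part
end Core
end RealApproximation
end PerL34
end HodgeCM
end
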